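import Literature.AlgebraicGeometry.HodgeTheory.KugaSatakeClassBetti
import Literature.AlgebraicGeometry.Motives.KugaSatakePolarizationProofs
import Literature.AlgebraicGeometry.Surfaces.K3Surface
import Literature.AlgebraicGeometry.Motives.MotivatedPeriodTorsor
import Literature.AlgebraicGeometry.Motives.SupersingularAbelianVariety
import Literature.AlgebraicGeometry.HodgeTheory.HodgeConjecture
import HarnessLib

/-!
# Floccari 2026, Theorem 3.5: under the Kuga–Satake Hodge conjecture for a K3 surface `S`, the Hodge conjecture for all powers of `S` ⟺ for all powers of its Kuga–Satake variety — NAMED FACT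

Layer `Literature/AlgebraicGeometry/Surfaces`.  CITE record for the Hodge-ladder stage-4 scoping
(run/shared/lean/pub/hodge-director/STAGE4-ABELIAN-MOTIVIC-TYPE.md, row 1 "K3 surfaces: powers",
erratum E2 of v2: the v1 junction shape `HC_K3Powers_of_KSH` — "Kuga–Satake–Hodge AND `HC_AV` ⟹ the Hodge
conjecture for all powers of K3 surfaces" — IS PRINTED, as an equivalence), on the REAL carriers of the
summit statement, using the real-carrier Kuga–Satake definitions of `HodgeTheory/KugaSatakeClassBetti`
(definition request D2 of the same document).

## Source (read: arXiv text `paper:arxiv-2501.02315`, §3 pp. 7–8)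

S. Floccari, *K3 surfaces associated with varieties of generalized Kummer type*, Geom. Topol. 30 (2026)
1129–1154 (arXiv:2501.02315) [Floccari2026]:
* §3.3: "We define the Kuga-Satake variety `KS(S)` of `S` as the abelian variety obtained from `(V, q)`
  [`V = H²(S, ℚ)_prim`] via the Kuga-Satake construction. … we get the embedding of Hodge structures
  `μ' : H²(S, ℚ)_prim ↪ H¹(KS(S), ℚ)^{⊗2} ⊂ H²(KS(S)², ℚ)`.  **Conjecture 3.3.** The morphism `μ'` is induced
  by an algebraic cycle on `S × KS(S)²`.  This is the Kuga-Satake Hodge conjecture".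
* Remark 3.4: "we may define `KS'(S)` as the Kuga-Satake variety built from the smaller Hodge structure of
  K3-type `H²_tr(S, ℚ)`; then the Kuga-Satake variety `KS(S)` built from `H²(S, ℚ)_prim` is isogenous to a
  power of `KS'(S)` (see [Huybrechts, K3 book]). Moreover, Conjecture 3.3 is equivalent to the statement that
  the embedding `μ' : H²_tr(S, ℚ) ↪ H¹(KS'(S), ℚ)^{⊗2} ⊂ H²(KS'(S)², ℚ)` analogous to (3.2) is induced by an
  algebraic cycle."
* **Theorem 3.5.** "Let `S` be a projective K3 surface. Assume that the Kuga-Satake Hodge conjecture holds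
  for `S`. Then the Hodge conjecture holds for all powers of `S` if and only if it holds for all powers of
  its Kuga-Satake variety `KS(S)`."  (Proof, §3.4, from Prop. 3.6: under Conj. 3.3,
  `𝔥²(S) ∈ ⟨𝔥¹(KS(S))⟩_Mot` and `G_Mot(𝔥¹(KS(S))) → G_Mot(𝔥²(S))` is an isogeny of degree `2`; direction
  "⇐": "as Conjecture 3.3 holds for `S` by assumption, we have `𝔥²(S) ∈ ⟨𝔥¹(KS(S))⟩_Mot`, and the Hodge
  conjecture for all powers of `KS(S)` clearly implies the Hodge conjecture for all powers of `S`";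
  direction "⇒" through `⟨𝔥¹(KS(S))⟩^ev_Mot = ⟨𝔥²(S)⟩_Mot`.)

## Rendering (tree carriers) and faithfulness

* "projective K3 surface": `IsK3Surface S` (smooth projective of dimension `2`, `H¹(𝒪) = 0`, trivial
  canonical bundle; file `K3Surface`).
* "the Kuga-Satake Hodge conjecture holds for `S`": the real-carrier PROPERTY
  `HodgeTheory.IsKSCorrespondenceAlgebraicBetti hS` of `KugaSatakeClassBetti` — Conjecture 3.3 in the
  `H²_tr`-form, to which it is "equivalent" by Remark 3.4 (quoted).
* "the Hodge conjecture holds for all powers of `S`": `∀ m, HodgeTheory.HodgeConjectureFor (m * 2) (S.pow m)`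
  for the cartesian powers `Motives.SchemeOver.pow` — symbol for symbol the stage-4 row-1 target
  `Summit.HodgeConjecture.CorCM.Stage4.HC_K3Powers` at `S`.
* "its Kuga-Satake variety `KS(S)`" (an abelian variety "up to isogeny", §3.2) and "all powers of" it: FOR
  EVERY presentation `(M, T, H, P, ε, j)` of the transcendental part `H²_tr(S, ℚ)` on the real carriers
  (`IsTranscendentalPartBetti`) and EVERY Kuga–Satake variety `(A, B, θ)` of `(T, H, P)`
  (`IsKugaSatakeVarietyBetti`: `H¹(A(ℂ); ℚ) ≅ C⁺(Q)` as Hodge structures — any member of the isogeny class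
  of Remark 3.4's `KS'(S)`), the tree's per-variety Hodge statement holds for every self-product
  `A^{m+1}` (`Motives.AbelianVariety.powSucc`, the abelian-variety powers used throughout the tree, with
  their own `dim`).  Reading: Floccari's `KS(S)` (from `H²_prim`) is isogenous to a power of `KS'(S)`
  (Remark 3.4), and "the Hodge conjecture for all powers" of an abelian variety depends only on its isogeny
  class and is equivalent for `A` and for a power `A^N` (powers of `A^N` are powers of `A`; a power of `A`
  is a factor, with a section, of a power of `A^N`) — so the clause for `KS(S)` and the clause "for every
  Kuga–Satake variety of `H²_tr`" say the same thing; the `∀` over presentations and over `(A, B, θ)` is the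
  tree's idiom for "its Kuga–Satake variety" (as in `Motives/KugaSatakeHodgeConjecture`), classically
  immaterial (Huybrechts Ch. 4 Rem. 2.7, Varesco 2023 Rem. 4.3) and classically NON-VACUOUS (real Hodge
  models exist; `T(S)_ℚ` with `∓` the intersection form is a polarized K3-type structure for one of the two
  signs `ε`; Kuga–Satake varieties exist by Riemann's theorem) — so neither side of the equivalence is
  trivialised.
* The power `A⁰ = Spec ℂ` / `S⁰` cases carry no content (Hodge classes on a point are algebraic).

## What is NOT here

Proposition 3.6 (motivic Galois groups), Theorem 2.2 (Arapura), any category of motives; the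
framework-`B` phrasing; any proof.  The record is the equivalence as printed; the stage-4 junction uses
direction "⇐" only.
-/

noncomputable section

open Literature.AlgebraicTopology.SingularHomology

namespace Literature.AlgebraicGeometry.Surfaces

/-- **Floccari 2026, Theorem 3.5: for a projective K3 surface `S` whose Kuga–Satake correspondence is
algebraic, all Hodge classes on all powers of `S` are algebraic if and only if all Hodge classes on all
powers of its Kuga–Satake variety are algebraic** (printed sentence, with the paper's names for the two
statements, in the module docstring: "Let `S` be a projective K3 surface. Assume that [the Kuga–Satake
correspondence of `S` is algebraic]. Then [every Hodge class on every power of `S` is algebraic] if and only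
if [the same holds for] all powers of its Kuga-Satake variety `KS(S)`.").  Rendering (module docstring): for
`S` with `IsK3Surface S` such that `HodgeTheory.IsKSCorrespondenceAlgebraicBetti` holds (§3.3 (3.3) in the
`H²_tr`-form of Remark 3.4, real carriers), the statements (a) the tree's per-variety Hodge statement for
`S.pow m` in dimension `m * 2`, every `m`, and (b) for every presentation of `H²_tr(S, ℚ)`
(`IsTranscendentalPartBetti`) and every Kuga–Satake variety `(A, B, θ)` of it (`IsKugaSatakeVarietyBetti`),
the per-variety Hodge statement for every abelian-variety power `A.powSucc m`, are EQUIVALENT.  A THEOREM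
in print (status: proved; unproved in the tree). [cite: Floccari2026, Thm. 3.5 and Remark 3.4 (§3.3–3.4)] -/
def Floccari2026_hodgeClasses_algebraic_K3Powers_iff_kugaSatakePowers : Prop :=
  ∀ ⦃S : Motives.SchemeOver ℂ⦄ (hS : IsK3Surface S),
    HodgeTheory.IsKSCorrespondenceAlgebraicBetti hS.isSmoothProjective →
      ((∀ m : ℕ, HodgeTheory.HodgeConjectureFor (m * 2) (Motives.SchemeOver.pow S m)) ↔
        ∀ (M : HodgeTheory.HodgeModel 2 S) (hM : M.IsHodgeSymmetric)
          (T : Type) [AddCommGroup T] [Module ℚ T] (H : Motives.HodgeStructure T 2) (P : H.Polarization)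
          (hT : H.hodgeNumber 2 0 = 1) (ε : ℤˣ)
          (j : H.Hom (HodgeTheory.bettiTwoHodgeStructure hS.isSmoothProjective M hM)),
          HodgeTheory.IsTranscendentalPartBetti hS.isSmoothProjective M hM H P ε j →
        ∀ (A : Motives.AbelianVariety ℂ) (B : HodgeTheory.HodgeModel A.dim A.X) (hB : B.IsHodgeSymmetric)
          (θ : Motives.bettiCohomology A.X 1 ≃ₗ[ℚ] CliffordAlgebra.even P.quadraticForm),
          HodgeTheory.IsKugaSatakeVarietyBetti H P hT A B hB θ →
        ∀ m : ℕ, HodgeTheory.HodgeConjectureFor (A.powSucc m).dim (A.powSucc m).X)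

/-! ### Non-vacuity of the Kuga–Satake binder: Kuga–Satake varieties exist on the real carriers (modulo Riemann's theorem) -/

/-- **Kuga–Satake varieties exist** (Kuga–Satake 1967; vG §5.7/§8.1 "defines an isogeny class of abelian
varieties"; Floccari §3.2 "This thus defines an abelian variety `KS(V)` up to isogeny, such that
`H¹(KS(V), ℚ) ≅ C⁺(V)`"), on the real carriers, GIVEN Riemann's theorem in the form of the tree's record
`HodgeTheory.DeligneMilne1982_Thm_6_20_essImage` (a THEOREM on the summit side,
`Summit.HodgeConjecture.CorCM.deligneMilne1982_Thm_6_20_essImage_holds`): for a finite-dimensional polarized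
`ℚ`-Hodge structure `(T, H, P)` of K3 type containing an orthogonal pair `e₁, e₂` with `P(eᵢ, eᵢ) < 0`
(vG 5.2), there are a complex abelian variety `A`, a Hodge-symmetric Hodge model `B` and
`θ : H¹(A(ℂ); ℚ) ≃ C⁺(Q)` with `IsKugaSatakeVarietyBetti H P _ A B hB θ`.  Ingredients, all PROVED in the
tree: the Kuga–Satake structure is polarisable (`kugaSatake_exists_polarization_traceForm_holds`, vG 5.9)
and effective (`isEffective_kugaSatake`), `C⁺(Q)` is finite-dimensional, and a bijective morphism of
Hodge structures maps `Fᵖ` onto `Fᵖ` (`Hom.map_F_eq_of_surjective`, strictness).  So the `∀ (A, B, θ)`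
binder of the record below is inhabited for every presentation. [cite: vanGeemen2000KugaSatakeHC, §5.7 and §8.1]
[cite: Floccari2026, §3.2] -/
theorem exists_isKugaSatakeVarietyBetti (hDM : HodgeTheory.DeligneMilne1982_Thm_6_20_essImage)
    {T : Type} [AddCommGroup T] [Module ℚ T] [Module.Finite ℚ T] (H : Motives.HodgeStructure T 2)
    (P : H.Polarization) (hK3 : H.IsOfK3Type)
    (he : ∃ e₁ e₂ : T, P.form e₁ e₂ = 0 ∧ P.form e₁ e₁ < 0 ∧ P.form e₂ e₂ < 0) :
    ∃ (A : Motives.AbelianVariety ℂ) (B : HodgeTheory.HodgeModel A.dim A.X) (hB : B.IsHodgeSymmetric)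
      (θ : Motives.bettiCohomology A.X 1 ≃ₗ[ℚ] CliffordAlgebra.even P.quadraticForm),
      HodgeTheory.IsKugaSatakeVarietyBetti H P hK3.1 A B hB θ := by
  have hpol : (H.kugaSatake P hK3.1).IsPolarizable :=
    Motives.HodgeStructure.isPolarizable_kugaSatake
      Motives.HodgeStructure.kugaSatake_exists_polarization_traceForm_holds H P hK3 he
  obtain ⟨A, B, hB, f, hf⟩ := hDM (H.kugaSatake P hK3.1) hpol (Motives.HodgeStructure.isEffective_kugaSatake H P hK3.1)
  refine ⟨A, B, hB, LinearEquiv.ofBijective f.toLinearMap hf, fun p ↦ ?_⟩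
  exact f.map_F_eq_of_surjective hf.2 p

namespace Floccari2026_hodgeClasses_algebraic_K3Powers_iff_kugaSatakePowers

/-- **Direction "⇐" of Theorem 3.5 (the one the stage-4 ladder uses):** for a projective K3 surface whose
Kuga–Satake correspondence is algebraic, the Hodge conjecture for all abelian-variety powers of every
Kuga–Satake variety of `H²_tr(S, ℚ)` implies the Hodge conjecture for every power `Sᵐ` ("the Hodge
conjecture for all powers of `KS(S)` clearly implies the Hodge conjecture for all powers of `S`", proof of
Thm. 3.5). [cite: Floccari2026, Thm. 3.5 (§3.4)] -/
theorem hodgeConjectureFor_pow_of_kugaSatakePowers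
    (h : Floccari2026_hodgeClasses_algebraic_K3Powers_iff_kugaSatakePowers) {S : Motives.SchemeOver ℂ}
    (hS : IsK3Surface S) (hKS : HodgeTheory.IsKSCorrespondenceAlgebraicBetti hS.isSmoothProjective)
    (hA : ∀ (M : HodgeTheory.HodgeModel 2 S) (hM : M.IsHodgeSymmetric)
      (T : Type) [AddCommGroup T] [Module ℚ T] (H : Motives.HodgeStructure T 2) (P : H.Polarization)
      (hT : H.hodgeNumber 2 0 = 1) (ε : ℤˣ)
      (j : H.Hom (HodgeTheory.bettiTwoHodgeStructure hS.isSmoothProjective M hM)),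
      HodgeTheory.IsTranscendentalPartBetti hS.isSmoothProjective M hM H P ε j →
      ∀ (A : Motives.AbelianVariety ℂ) (B : HodgeTheory.HodgeModel A.dim A.X) (hB : B.IsHodgeSymmetric)
        (θ : Motives.bettiCohomology A.X 1 ≃ₗ[ℚ] CliffordAlgebra.even P.quadraticForm),
        HodgeTheory.IsKugaSatakeVarietyBetti H P hT A B hB θ →
      ∀ m : ℕ, HodgeTheory.HodgeConjectureFor (A.powSucc m).dim (A.powSucc m).X)
    (m : ℕ) : HodgeTheory.HodgeConjectureFor (m * 2) (Motives.SchemeOver.pow S m) :=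
  (h hS hKS).mpr hA m

/-- If the Hodge conjecture holds for EVERY complex abelian variety (the stage-3 conclusion `HC_AV` of the
Hodge ladder, here spelled out), then under Theorem 3.5 every projective K3 surface with algebraic
Kuga–Satake correspondence satisfies the Hodge conjecture on all its powers — the printed form of the
stage-4 row-1 junction "KSH ∧ HC_AV ⟹ HC_K3Powers". [cite: Floccari2026, Thm. 3.5 (§3.4)] -/
theorem hodgeConjectureFor_pow_of_forall_abelianVariety
    (h : Floccari2026_hodgeClasses_algebraic_K3Powers_iff_kugaSatakePowers)
    (hAV : ∀ A : Motives.AbelianVariety ℂ, HodgeTheory.HodgeConjectureFor A.dim A.X)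
    {S : Motives.SchemeOver ℂ} (hS : IsK3Surface S)
    (hKS : HodgeTheory.IsKSCorrespondenceAlgebraicBetti hS.isSmoothProjective) (m : ℕ) :
    HodgeTheory.HodgeConjectureFor (m * 2) (Motives.SchemeOver.pow S m) :=
  hodgeConjectureFor_pow_of_kugaSatakePowers h hS hKS
    (fun _ _ _ _ _ _ _ _ _ _ _ A _ _ _ _ m' ↦ hAV (A.powSucc m')) m

end Floccari2026_hodgeClasses_algebraic_K3Powers_iff_kugaSatakePowers

end Literature.AlgebraicGeometry.Surfaces

end
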